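import Summits.Schanuel.Schanuel.Theorems.SoloInformedBoxPrinciple
import HarnessLib.Audit.Tags

/-!
# Roy's additive small value estimates: the Dirichlet exponent and the `σ/4` gap (soloist)

Soloist file (`solo-Schanuel-informed`, s148, 2026-08-29), companion of `SoloInformedBoxPrinciple`.
Source: [Roy2010 = D. Roy, *Small value estimates for the additive group*, Int. J. Number Theory
**6** (2010), arXiv:0708.2307].  Roy's programme ([Roy2001], in the tree as
`Literature.NumberTheory.Transcendental.RoyCriterion`) replaces "criterion + zero estimate" by
SMALL VALUE ESTIMATES; for `𝔾ₐ × 𝔾ₘ` the conjectured estimate is EQUIVALENT to Schanuel's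
conjecture, and [Roy2010] proves the first such estimates for the toy group `𝔾ₐ`.  The soloist's
statement (`paper/SHARPEST.md` §2 E5, §5 W1) cited this toy layer; this file types it.

## What is typed

Data at level `n` (Roy's Thm 1.1, `m = 1`, points `iξ`): a non-zero `P ∈ ℤ[X]`, `deg P ≤ n`,
height `≤ exp(n^β)`, `|P^{[j]}(iξ)| ≤ exp(-n^ν)` for all integers `0 ≤ i ≤ n^σ`, `0 ≤ j ≤ n^τ`
(`P^{[j]}` = divided derivative = `Polynomial.hasseDeriv j P`).  `RoyAdditiveSmall ξ β σ τ ν n` is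
the set of such `P`; the SMALL VALUE ESTIMATE with exponent `ν` says it is EMPTY for infinitely
many `n` (Roy's wording with a sequence `(P_n)_{n ≥ n₀}` and "`max … > exp(-n^ν)` for infinitely
many `n`" is the same statement); `royAdditiveSVEExponents ξ β σ τ ⊆ ℝ` is the set of such `ν` —
an upper set (§1), so the content is ONE THRESHOLD `ν*(ξ; β, σ, τ) = inf royAdditiveSVEExponents`.

* §2 THE DIRICHLET EXPONENT IS A THEOREM (`royAdditiveSmall_nonempty_eventually`, [Roy2010,
  Prop. 12.1, `m = 1`]): for every `ξ ∈ ℂ`, `0 ≤ σ`, `0 ≤ τ`, `σ + τ < 1`, `σ + τ < β` and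
  `ν < 1 + β − σ − τ` the set `RoyAdditiveSmall ξ β σ τ ν n` is non-empty for all large `n`; hence
  `ν* ≥ 1 + β − σ − τ` (`royAdditiveSVEExponents_subset_Ici`).  Proof: the box principle of
  `SoloInformedBoxPrinciple` with `n + 1` unknowns, `2(⌊n^σ⌋+1)(⌊n^τ⌋+1) ≤ 8n^{σ+τ}` real
  conditions, coefficients `≤ 2^n(1 + n^σ‖ξ‖)^n`, and the budget
  `8 n^{σ+τ} (n^β + n^ν + c·n^{1+ε}) ≤ n^{1+β}` for large `n` (`eventually_dirichlet_budget`).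
* §3 THE DEEP SIDE AND THE WINDOW.  [Roy2010, Thm 1.1 (3)] (Roy's "main result", proved by
  contradiction through a gcd estimate for the `P(aT)`, `a` prime `≤ n^μ` (his Thm 1.2), a
  Zarankiewicz-type product estimate at the points `abξ` (his Thm 1.3) and Gel'fond-type
  linearization, with `μ = σ/4` — the source of the gap; QUOTED here, not typed as a tree fact):
  for transcendental `ξ`, `β > 1`, `(3/4)σ + τ < 1`, every `ν > 1 + β − (3/4)σ − τ` is in the set.
  Roy [§1]: "Dirichlet box principle shows that it would be false for a value of `ν` smaller than
  `1 + β − σ − τ`.  This shows a gap of `σ/4`."  So for `σ + τ < 1` the threshold sits in the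
  WINDOW `[1 + β − σ − τ, 1 + β − (3/4)σ − τ]`, whose left end is this file's theorem; the OPEN
  statement "the window is its left end" is `RoyAdditiveDirichletExponent` (tag `conjecture`:
  unproved and ours to state — Roy records the gap, he does not conjecture its closure).

## Conventions and faithfulness

Roy's height `H(P) = ‖P‖/cont(P)` [Roy2010 §2] satisfies `H(P) ≤ polyHeight P`, so §2 (naive
height `≤ exp(n^β)`) IMPLIES Roy's Prop. 12.1 (`m = 1`) as printed, and his Thm 1.1 (3) as
printed IMPLIES the membership quoted in §3.  Prop. 12.1 assumes `β, σ, τ, ν > 0`, `1 < ν`; the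
proof needs only the hypotheses of §2.  For `m ≥ 3` points the analogue of
`RoyAdditiveDirichletExponent` is FALSE for suitable `ℚ`-linearly independent `ξ₁, …, ξ_m`
[Roy2010, Prop. 12.2]; for one point no such phenomenon is known, which is why the `m = 1`
optimal statement is recorded as open rather than dismissed.
-/

namespace Summit.Schanuel.Schanuel.Theorems

open Filter Polynomial

/-! ## §1 Height, the small-value sets, the estimate -/

/-- The naive height `max_k |coeff_k P|` of an integer polynomial (`0` for `P = 0`).  Roy's
projective height `‖P‖/cont(P)` is at most this. -/
def polyHeight (P : ℤ[X]) : ℕ := P.support.sup fun k => (P.coeff k).natAbs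

/-- Every coefficient is bounded by the height. -/
theorem natAbs_coeff_le_polyHeight (P : ℤ[X]) (k : ℕ) : (P.coeff k).natAbs ≤ polyHeight P := by
  unfold polyHeight
  by_cases hk : P.coeff k = 0
  · simp [hk]
  · exact Finset.le_sup (f := fun k => (P.coeff k).natAbs) (Polynomial.mem_support_iff.mpr hk)

/-- A uniform bound on the coefficients bounds the height. -/
theorem polyHeight_le_of_forall_abs_le {P : ℤ[X]} {H : ℕ} (h : ∀ k, |P.coeff k| ≤ H) :
    polyHeight P ≤ H := by
  unfold polyHeight
  refine Finset.sup_le fun k _ => ?_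
  show (P.coeff k).natAbs ≤ H
  have := h k
  rw [Int.abs_eq_natAbs] at this
  exact_mod_cast this

/-- **Roy's data at level `n`** [Roy2010, Thm 1.1, `m = 1`]: the non-zero `P ∈ ℤ[X]` with
`deg P ≤ n`, naive height `≤ exp(n^β)`, and `‖P^{[j]}(iξ)‖ ≤ exp(-n^ν)` for all naturals
`i ≤ n^σ`, `j ≤ n^τ` (`P^{[j]} = hasseDeriv j P`, the divided derivative). -/
def RoyAdditiveSmall (ξ : ℂ) (β σ τ ν : ℝ) (n : ℕ) : Set ℤ[X] :=
  {P | P ≠ 0 ∧ P.natDegree ≤ n ∧ (polyHeight P : ℝ) ≤ Real.exp ((n : ℝ) ^ β) ∧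
    ∀ i j : ℕ, (i : ℝ) ≤ (n : ℝ) ^ σ → (j : ℝ) ≤ (n : ℝ) ^ τ →
      ‖aeval ((i : ℂ) * ξ) (hasseDeriv j P)‖ ≤ Real.exp (-(n : ℝ) ^ ν)}

/-- **The exponents of the additive small value estimate at `ξ`**: `ν` is in the set iff for
infinitely many `n` there is NO polynomial as in `RoyAdditiveSmall ξ β σ τ ν n` — equivalently
(Roy's wording) for every sequence `(P_n)_{n ≥ n₀}` of non-zero integer polynomials with
`deg P_n ≤ n`, `H(P_n) ≤ exp(n^β)`, one has `max {‖P_n^{[j]}(iξ)‖ ; i ≤ n^σ, j ≤ n^τ} > exp(-n^ν)`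
for infinitely many `n`. -/
def royAdditiveSVEExponents (ξ : ℂ) (β σ τ : ℝ) : Set ℝ :=
  {ν | ∃ᶠ n : ℕ in atTop, ¬ (RoyAdditiveSmall ξ β σ τ ν n).Nonempty}

/-- The small-value sets shrink as `ν` grows (`n ≥ 1`). -/
theorem royAdditiveSmall_anti (ξ : ℂ) (β σ τ : ℝ) {ν ν' : ℝ} (h : ν ≤ ν') {n : ℕ} (hn : 1 ≤ n) :
    RoyAdditiveSmall ξ β σ τ ν' n ⊆ RoyAdditiveSmall ξ β σ τ ν n := by
  rintro P ⟨hP0, hdeg, hht, hsmall⟩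
  refine ⟨hP0, hdeg, hht, fun i j hi hj => (hsmall i j hi hj).trans ?_⟩
  have hn' : (1 : ℝ) ≤ n := by exact_mod_cast hn
  exact Real.exp_le_exp.mpr (neg_le_neg (Real.rpow_le_rpow_of_exponent_le hn' h))

/-- The set of exponents is an UPPER SET of `ℝ` (asking for smaller values makes emptiness
easier): everything is one threshold `inf royAdditiveSVEExponents ξ β σ τ ∈ [-∞, +∞]`. -/
theorem isUpperSet_royAdditiveSVEExponents (ξ : ℂ) (β σ τ : ℝ) :
    IsUpperSet (royAdditiveSVEExponents ξ β σ τ) := by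
  intro ν ν' h hν
  have hν' : ∃ᶠ n : ℕ in atTop, ¬ (RoyAdditiveSmall ξ β σ τ ν n).Nonempty := hν
  show ∃ᶠ n : ℕ in atTop, ¬ (RoyAdditiveSmall ξ β σ τ ν' n).Nonempty
  refine (Filter.Frequently.and_eventually hν' (eventually_ge_atTop 1)).mono ?_
  rintro n ⟨hno, hn⟩ hne
  exact hno (hne.mono (royAdditiveSmall_anti ξ β σ τ h hn))

/-! ## §2 The Dirichlet exponent `1 + β − σ − τ` is a theorem -/

/-- For `a < b` and any constant `C`, eventually `C · n^a ≤ n^b`. -/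
theorem eventually_const_mul_rpow_le_rpow {a b : ℝ} (hab : a < b) (C : ℝ) :
    ∀ᶠ n : ℕ in atTop, C * (n : ℝ) ^ a ≤ (n : ℝ) ^ b := by
  have ht : Tendsto (fun n : ℕ => (n : ℝ) ^ (b - a)) atTop atTop :=
    (tendsto_rpow_atTop (sub_pos.mpr hab)).comp tendsto_natCast_atTop_atTop
  filter_upwards [ht.eventually_ge_atTop C, eventually_ge_atTop 1] with n hC hn
  have hn0 : (0 : ℝ) < n := by exact_mod_cast hn
  have hna : 0 ≤ (n : ℝ) ^ a := Real.rpow_nonneg hn0.le a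
  calc C * (n : ℝ) ^ a ≤ (n : ℝ) ^ (b - a) * (n : ℝ) ^ a := mul_le_mul_of_nonneg_right hC hna
    _ = (n : ℝ) ^ b := by rw [← Real.rpow_add hn0, sub_add_cancel]

/-- The counting budget of the box principle: if `σ + τ < 1`, `ν < 1 + β − σ − τ` and
`σ + τ + (1 + ε) < 1 + β`, then for every `c`, eventually
`8 n^{σ+τ} (n^β + n^ν + c n^{1+ε}) ≤ n^{1+β}`. -/
theorem eventually_dirichlet_budget {β σ τ ν ε : ℝ} (hστ : σ + τ < 1)
    (hν : ν < 1 + β - σ - τ) (hε : σ + τ + (1 + ε) < 1 + β) (c : ℝ) :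
    ∀ᶠ n : ℕ in atTop, 8 * (n : ℝ) ^ (σ + τ) *
        ((n : ℝ) ^ β + (n : ℝ) ^ ν + c * (n : ℝ) ^ (1 + ε)) ≤ (n : ℝ) ^ (1 + β) := by
  have h1 : σ + τ + β < 1 + β := by linarith
  have h2 : σ + τ + ν < 1 + β := by linarith
  filter_upwards [eventually_const_mul_rpow_le_rpow h1 24, eventually_const_mul_rpow_le_rpow h2 24,
    eventually_const_mul_rpow_le_rpow hε (24 * c), eventually_ge_atTop 1] with n hA hB hC hn
  have hn0 : (0 : ℝ) < n := by exact_mod_cast hn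
  rw [Real.rpow_add hn0] at hA hB hC
  linarith [hA, hB, hC]

/-- `log (n + 1) ≤ 2 n^ε / ε` for `n ≥ 1`, `0 < ε ≤ 1` (from `log x ≤ x^ε/ε`). -/
theorem log_natCast_add_one_le {n : ℕ} (hn : 1 ≤ n) {ε : ℝ} (hε : 0 < ε) (hε1 : ε ≤ 1) :
    Real.log ((n : ℝ) + 1) ≤ 2 * (n : ℝ) ^ ε / ε := by
  have hn' : (1 : ℝ) ≤ n := by exact_mod_cast hn
  have h1 : Real.log ((n : ℝ) + 1) ≤ ((n : ℝ) + 1) ^ ε / ε :=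
    Real.log_le_rpow_div (by positivity) hε
  have h2 : ((n : ℝ) + 1) ^ ε ≤ (2 * (n : ℝ)) ^ ε :=
    Real.rpow_le_rpow (by positivity) (by linarith) hε.le
  have h3 : (2 * (n : ℝ)) ^ ε = (2 : ℝ) ^ ε * (n : ℝ) ^ ε :=
    Real.mul_rpow (by norm_num) (by positivity)
  have h4 : (2 : ℝ) ^ ε ≤ 2 := by
    calc (2 : ℝ) ^ ε ≤ (2 : ℝ) ^ (1 : ℝ) := Real.rpow_le_rpow_of_exponent_le (by norm_num) hε1
      _ = 2 := Real.rpow_one 2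
  have h5 : ((n : ℝ) + 1) ^ ε ≤ 2 * (n : ℝ) ^ ε := by
    rw [h3] at h2
    exact h2.trans (mul_le_mul_of_nonneg_right h4 (Real.rpow_nonneg (by positivity) _))
  calc Real.log ((n : ℝ) + 1) ≤ ((n : ℝ) + 1) ^ ε / ε := h1
    _ ≤ 2 * (n : ℝ) ^ ε / ε := by gcongr

set_option maxHeartbeats 800000 in
/-- **The Dirichlet side of the additive small value estimate** [Roy2010, Prop. 12.1, `m = 1`],
with the naive height.  For every `ξ ∈ ℂ` and exponents `0 ≤ σ`, `0 ≤ τ`, `σ + τ < 1`,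
`σ + τ < β`, `ν < 1 + β − σ − τ`: for all sufficiently large `n` there is a non-zero `P ∈ ℤ[X]`
with `deg P ≤ n`, all `|coeff| ≤ exp(n^β)`, and `‖P^{[j]}(iξ)‖ ≤ exp(-n^ν)` for all naturals
`i ≤ n^σ`, `j ≤ n^τ`. -/
theorem royAdditiveSmall_nonempty_eventually (ξ : ℂ) {β σ τ ν : ℝ} (hσ : 0 ≤ σ) (hτ : 0 ≤ τ)
    (hστ : σ + τ < 1) (hβ : σ + τ < β) (hν : ν < 1 + β - σ - τ) :
    ∀ᶠ n : ℕ in atTop, (RoyAdditiveSmall ξ β σ τ ν n).Nonempty := by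
  -- an auxiliary exponent `ε` and the constant `c` of the budget
  obtain ⟨ε, hε0, hε1, hεβ⟩ : ∃ ε : ℝ, 0 < ε ∧ ε ≤ 1 ∧ σ + τ + (1 + ε) < 1 + β :=
    ⟨min 1 ((β - σ - τ) / 2), lt_min one_pos (by linarith), min_le_left _ _, by
      have := min_le_right (1 : ℝ) ((β - σ - τ) / 2); linarith⟩
  obtain ⟨c, hc⟩ : ∃ c : ℝ, c = 3 + 4 / ε + ‖ξ‖ := ⟨_, rfl⟩
  filter_upwards [eventually_dirichlet_budget hστ hν hεβ c, eventually_ge_atTop 1] with n hbud hn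
  have hn' : (1 : ℝ) ≤ n := by exact_mod_cast hn
  have hn0 : (0 : ℝ) < n := by linarith
  -- the parameters at level `n`
  obtain ⟨I, hI⟩ : ∃ I : ℕ, I = ⌊(n : ℝ) ^ σ⌋₊ := ⟨_, rfl⟩
  obtain ⟨J, hJ⟩ : ∃ J : ℕ, J = ⌊(n : ℝ) ^ τ⌋₊ := ⟨_, rfl⟩
  obtain ⟨H, hH⟩ : ∃ H : ℕ, H = ⌊Real.exp ((n : ℝ) ^ β)⌋₊ := ⟨_, rfl⟩
  obtain ⟨E, hE⟩ : ∃ E : ℝ, E = Real.exp ((n : ℝ) ^ ν) := ⟨_, rfl⟩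
  obtain ⟨δ, hδ⟩ : ∃ δ : ℝ, δ = Real.exp (-(n : ℝ) ^ ν) / 2 := ⟨_, rfl⟩
  obtain ⟨A, hA⟩ : ∃ A : ℝ, A = 2 ^ n * (1 + I * ‖ξ‖) ^ n := ⟨_, rfl⟩
  obtain ⟨Q, hQ⟩ : ∃ Q : ℝ, Q = ((n : ℝ) + 1) * A * H * E := ⟨_, rfl⟩
  obtain ⟨R, hR⟩ : ∃ R : ℕ, R = ⌈2 * Q⌉₊ := ⟨_, rfl⟩
  -- elementary facts about them
  have hδ0 : 0 < δ := by rw [hδ]; positivity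
  have h2δ : 2 * δ = Real.exp (-(n : ℝ) ^ ν) := by rw [hδ]; ring
  have hE0 : 0 < E := by rw [hE]; exact Real.exp_pos _
  have hE1 : 1 ≤ E := by rw [hE]; exact Real.one_le_exp (Real.rpow_nonneg hn0.le _)
  have hIσ : (I : ℝ) ≤ (n : ℝ) ^ σ := by rw [hI]; exact Nat.floor_le (Real.rpow_nonneg hn0.le _)
  have hJτ : (J : ℝ) ≤ (n : ℝ) ^ τ := by rw [hJ]; exact Nat.floor_le (Real.rpow_nonneg hn0.le _)
  have hσ1 : 1 ≤ (n : ℝ) ^ σ := Real.one_le_rpow hn' hσ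
  have hτ1 : 1 ≤ (n : ℝ) ^ τ := Real.one_le_rpow hn' hτ
  have hσn : (n : ℝ) ^ σ ≤ n := by
    calc (n : ℝ) ^ σ ≤ (n : ℝ) ^ (1 : ℝ) :=
          Real.rpow_le_rpow_of_exponent_le hn' (by linarith)
      _ = n := Real.rpow_one _
  have hHexp : (H : ℝ) ≤ Real.exp ((n : ℝ) ^ β) := by
    rw [hH]; exact Nat.floor_le (Real.exp_pos _).le
  have hH1 : (1 : ℝ) ≤ H := by
    have : 1 ≤ H := by
      rw [hH]; refine Nat.le_floor ?_
      simpa using Real.one_le_exp (Real.rpow_nonneg hn0.le β)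
    exact_mod_cast this
  have hH0 : (0 : ℝ) < H := by linarith
  have hexpH : Real.exp ((n : ℝ) ^ β) < (H : ℝ) + 1 := by rw [hH]; exact Nat.lt_floor_add_one _
  have hIn : (0 : ℝ) ≤ I * ‖ξ‖ := by positivity
  have hB1 : (1 : ℝ) ≤ 1 + I * ‖ξ‖ := by linarith
  have hA1 : 1 ≤ A := by
    rw [hA]
    exact one_le_mul_of_one_le_of_one_le (one_le_pow₀ (by norm_num)) (one_le_pow₀ hB1)
  have hA0 : 0 < A := by linarith
  have hn10 : (0 : ℝ) < (n : ℝ) + 1 := by linarith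
  have hQ1 : 1 ≤ Q := by
    rw [hQ]
    exact one_le_mul_of_one_le_of_one_le
      (one_le_mul_of_one_le_of_one_le (one_le_mul_of_one_le_of_one_le (by linarith) hA1) hH1) hE1
  have hQ0 : 0 < Q := by linarith
  have hRge : 2 * Q ≤ R := by rw [hR]; exact Nat.le_ceil _
  have hRlt : (R : ℝ) < 2 * Q + 1 := by rw [hR]; exact Nat.ceil_lt_add_one (by linarith)
  have h2R1 : (2 * R + 1 : ℝ) ≤ 7 * Q := by linarith
  have h2R0 : (0 : ℝ) < 2 * R + 1 := by positivity
  -- (i) the box radius hypothesis of the box principle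
  have hEδ : 2 * (E * δ) = 1 := by
    rw [hE, hδ, Real.exp_neg]
    field_simp
  have hRδ : ((n + 1 : ℕ) : ℝ) * (2 ^ n * (1 + I * ‖ξ‖) ^ n) * H ≤ R * δ := by
    calc ((n + 1 : ℕ) : ℝ) * (2 ^ n * (1 + I * ‖ξ‖) ^ n) * H
        = ((n + 1 : ℕ) : ℝ) * (2 ^ n * (1 + I * ‖ξ‖) ^ n) * H * (2 * (E * δ)) := by
          rw [hEδ, mul_one]
      _ = 2 * Q * δ := by rw [hQ, hA]; push_cast; ring
      _ ≤ R * δ := mul_le_mul_of_nonneg_right hRge hδ0.le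
  -- (ii) the counting hypothesis, in logarithmic form
  have hM : (2 * (((I : ℝ) + 1) * ((J : ℝ) + 1))) ≤ 8 * (n : ℝ) ^ (σ + τ) := by
    have hI1 : (I : ℝ) + 1 ≤ 2 * (n : ℝ) ^ σ := by linarith
    have hJ1 : (J : ℝ) + 1 ≤ 2 * (n : ℝ) ^ τ := by linarith
    calc (2 * (((I : ℝ) + 1) * ((J : ℝ) + 1)))
        ≤ 2 * ((2 * (n : ℝ) ^ σ) * (2 * (n : ℝ) ^ τ)) := by
          have := mul_le_mul hI1 hJ1 (by positivity) (by positivity)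
          linarith
      _ = 8 * ((n : ℝ) ^ σ * (n : ℝ) ^ τ) := by ring
      _ = 8 * (n : ℝ) ^ (σ + τ) := by rw [Real.rpow_add hn0]
  -- the pieces of `log (7Q)`
  have hL1 : Real.log ((n : ℝ) + 1) ≤ 2 * (n : ℝ) ^ ε / ε := log_natCast_add_one_le hn hε0 hε1
  have hlogA : Real.log A ≤ n + n * (2 * (n : ℝ) ^ ε / ε + ‖ξ‖) := by
    have hB0 : (0 : ℝ) < 1 + I * ‖ξ‖ := by linarith
    have hlogA' : Real.log A = n * Real.log 2 + n * Real.log (1 + I * ‖ξ‖) := by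
      rw [hA, Real.log_mul (by positivity) (pow_pos hB0 n).ne', Real.log_pow, Real.log_pow]
    have hlog2 : Real.log 2 ≤ 1 := by
      have := Real.log_le_sub_one_of_pos (show (0 : ℝ) < 2 by norm_num); linarith
    have hBle : 1 + (I : ℝ) * ‖ξ‖ ≤ ((n : ℝ) + 1) * (1 + ‖ξ‖) := by
      have hIle : (I : ℝ) * ‖ξ‖ ≤ n * ‖ξ‖ :=
        mul_le_mul_of_nonneg_right (hIσ.trans hσn) (norm_nonneg _)
      nlinarith [norm_nonneg ξ, hn0.le]
    have hlogB : Real.log (1 + I * ‖ξ‖) ≤ 2 * (n : ℝ) ^ ε / ε + ‖ξ‖ := by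
      have hξ0 : (0 : ℝ) < 1 + ‖ξ‖ := by positivity
      calc Real.log (1 + I * ‖ξ‖) ≤ Real.log (((n : ℝ) + 1) * (1 + ‖ξ‖)) :=
            Real.log_le_log hB0 hBle
        _ = Real.log ((n : ℝ) + 1) + Real.log (1 + ‖ξ‖) := Real.log_mul hn10.ne' hξ0.ne'
        _ ≤ 2 * (n : ℝ) ^ ε / ε + ‖ξ‖ := by
            have := Real.log_le_sub_one_of_pos hξ0
            linarith
    rw [hlogA']
    have hn0' : (0 : ℝ) ≤ n := hn0.le
    have t1 := mul_le_mul_of_nonneg_left hlog2 hn0'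
    have t2 := mul_le_mul_of_nonneg_left hlogB hn0'
    linarith
  have hlogH : Real.log H ≤ (n : ℝ) ^ β := (Real.log_le_iff_le_exp hH0).mpr hHexp
  have hlogE : Real.log E = (n : ℝ) ^ ν := by rw [hE, Real.log_exp]
  have hlog7Q : Real.log (7 * Q) =
      Real.log 7 + (Real.log ((n : ℝ) + 1) + Real.log A + Real.log H + Real.log E) := by
    rw [Real.log_mul (by norm_num) hQ0.ne', hQ,
      Real.log_mul (mul_pos (mul_pos hn10 hA0) hH0).ne' hE0.ne',
      Real.log_mul (mul_pos hn10 hA0).ne' hH0.ne', Real.log_mul hn10.ne' hA0.ne']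
  -- powers of `n` used to absorb the lower-order terms
  have hN1 : (1 : ℝ) ≤ (n : ℝ) ^ (1 + ε) := Real.one_le_rpow hn' (by linarith)
  have hnN : (n : ℝ) ≤ (n : ℝ) ^ (1 + ε) := by
    calc (n : ℝ) = (n : ℝ) ^ (1 : ℝ) := (Real.rpow_one _).symm
      _ ≤ (n : ℝ) ^ (1 + ε) := Real.rpow_le_rpow_of_exponent_le hn' (by linarith)
  have hεN : (n : ℝ) ^ ε ≤ (n : ℝ) ^ (1 + ε) :=
    Real.rpow_le_rpow_of_exponent_le hn' (by linarith)
  have hnε : (n : ℝ) * (n : ℝ) ^ ε = (n : ℝ) ^ (1 + ε) := by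
    rw [Real.rpow_add hn0, Real.rpow_one]
  have hlow : 2 + 2 * (n : ℝ) ^ ε / ε + (n + n * (2 * (n : ℝ) ^ ε / ε + ‖ξ‖))
      ≤ c * (n : ℝ) ^ (1 + ε) := by
    have e1 : 2 * (n : ℝ) ^ ε / ε ≤ 2 / ε * (n : ℝ) ^ (1 + ε) := by
      rw [show 2 * (n : ℝ) ^ ε / ε = 2 / ε * (n : ℝ) ^ ε by ring]
      exact mul_le_mul_of_nonneg_left hεN (by positivity)
    have e2 : (n : ℝ) * (2 * (n : ℝ) ^ ε / ε) = 2 / ε * (n : ℝ) ^ (1 + ε) := by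
      rw [← hnε]; ring
    have e3 : (n : ℝ) * ‖ξ‖ ≤ ‖ξ‖ * (n : ℝ) ^ (1 + ε) := by
      rw [mul_comm]; exact mul_le_mul_of_nonneg_left hnN (norm_nonneg _)
    have e4 : c * (n : ℝ) ^ (1 + ε) =
        3 * (n : ℝ) ^ (1 + ε) + 2 / ε * (n : ℝ) ^ (1 + ε) + 2 / ε * (n : ℝ) ^ (1 + ε)
          + ‖ξ‖ * (n : ℝ) ^ (1 + ε) := by rw [hc]; ring
    rw [e4, mul_add, e2]
    linarith
  have hlog7 : Real.log 7 ≤ 2 := by  -- `7 = 1 + 2 + 2 + 4/3 + 2/3 ≤ exp 2`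
    rw [Real.log_le_iff_le_exp (by norm_num)]
    have h := Real.sum_le_exp_of_nonneg (show (0 : ℝ) ≤ 2 by norm_num) 5
    norm_num [Finset.sum_range_succ, Nat.factorial] at h
    linarith
  have hlogR : Real.log (2 * R + 1 : ℝ) ≤ (n : ℝ) ^ β + (n : ℝ) ^ ν + c * (n : ℝ) ^ (1 + ε) := by
    calc Real.log (2 * R + 1 : ℝ) ≤ Real.log (7 * Q) := Real.log_le_log h2R0 h2R1
      _ = Real.log 7 + (Real.log ((n : ℝ) + 1) + Real.log A + Real.log H + Real.log E) := hlog7Q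
      _ ≤ 2 + (2 * (n : ℝ) ^ ε / ε + (n + n * (2 * (n : ℝ) ^ ε / ε + ‖ξ‖))
            + (n : ℝ) ^ β + (n : ℝ) ^ ν) := by
          rw [hlogE]; linarith [hlog7]
      _ ≤ (n : ℝ) ^ β + (n : ℝ) ^ ν + c * (n : ℝ) ^ (1 + ε) := by linarith
  have hlogR0 : 0 ≤ Real.log (2 * R + 1 : ℝ) :=
    Real.log_nonneg (by have : (0 : ℝ) ≤ R := Nat.cast_nonneg _; linarith)
  have hMlog : (2 * (((I : ℝ) + 1) * ((J : ℝ) + 1))) * Real.log (2 * R + 1 : ℝ)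
      ≤ (n : ℝ) ^ (1 + β) :=
    calc (2 * (((I : ℝ) + 1) * ((J : ℝ) + 1))) * Real.log (2 * R + 1 : ℝ)
        ≤ (8 * (n : ℝ) ^ (σ + τ)) * ((n : ℝ) ^ β + (n : ℝ) ^ ν + c * (n : ℝ) ^ (1 + ε)) :=
          mul_le_mul hM hlogR hlogR0 (by positivity)
      _ ≤ (n : ℝ) ^ (1 + β) := hbud
  have hlogH1 : (n : ℝ) ^ β < Real.log ((H : ℝ) + 1) := by
    have := Real.log_lt_log (Real.exp_pos _) hexpH
    rwa [Real.log_exp] at this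
  have hKlog : (n : ℝ) ^ (1 + β) < ((n : ℝ) + 1) * Real.log ((H : ℝ) + 1) := by
    have hnβ : 0 < (n : ℝ) ^ β := Real.rpow_pos_of_pos hn0 β
    calc (n : ℝ) ^ (1 + β) = n * (n : ℝ) ^ β := by rw [Real.rpow_add hn0, Real.rpow_one]
      _ < ((n : ℝ) + 1) * (n : ℝ) ^ β := by linarith
      _ ≤ ((n : ℝ) + 1) * Real.log ((H : ℝ) + 1) :=
          mul_le_mul_of_nonneg_left hlogH1.le hn10.le
  have hcardR : ((2 * R + 1 : ℕ) : ℝ) ^ (2 * ((I + 1) * (J + 1)))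
      < ((H + 1 : ℕ) : ℝ) ^ (n + 1) := by
    rw [← Real.log_lt_log_iff (by positivity) (by positivity), Real.log_pow, Real.log_pow]
    push_cast
    exact hMlog.trans_lt hKlog
  have hcard : (2 * R + 1) ^ (2 * ((I + 1) * (J + 1))) < (H + 1) ^ (n + 1) := by
    exact_mod_cast hcardR
  -- (iii) the box principle
  obtain ⟨P, hP0, hdeg, hcoeff, hsmall⟩ :=
    exists_int_poly_small_hasseDeriv ξ n I J H R hδ0 hRδ hcard
  refine ⟨P, hP0, hdeg, ?_, ?_⟩
  · calc (polyHeight P : ℝ) ≤ H := by exact_mod_cast polyHeight_le_of_forall_abs_le hcoeff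
      _ ≤ Real.exp ((n : ℝ) ^ β) := hHexp
  · intro i j hi hj
    have hiI : i ≤ I := by rw [hI]; exact Nat.le_floor hi
    have hjJ : j ≤ J := by rw [hJ]; exact Nat.le_floor hj
    rw [← h2δ]
    exact (hsmall i j hiI hjJ).le

/-- Below the Dirichlet exponent the estimate FAILS, for every `ξ` (transcendental or not):
`σ + τ < 1`, `σ + τ < β`, `ν < 1 + β − σ − τ ⟹ ν ∉ royAdditiveSVEExponents ξ β σ τ`.  This is
the "would be false for a value of `ν` smaller than `1 + β − σ − τ`" of [Roy2010, §1]. -/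
theorem not_mem_royAdditiveSVEExponents_of_lt_dirichlet (ξ : ℂ) {β σ τ ν : ℝ} (hσ : 0 ≤ σ)
    (hτ : 0 ≤ τ) (hστ : σ + τ < 1) (hβ : σ + τ < β) (hν : ν < 1 + β - σ - τ) :
    ν ∉ royAdditiveSVEExponents ξ β σ τ := fun h =>
  h ((royAdditiveSmall_nonempty_eventually ξ hσ hτ hστ hβ hν).mono fun _ hn => not_not_intro hn)

/-- **The threshold is at least the Dirichlet exponent**: for `0 ≤ σ, 0 ≤ τ`, `σ + τ < 1`,
`σ + τ < β`, `royAdditiveSVEExponents ξ β σ τ ⊆ [1 + β − σ − τ, ∞)`. -/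
theorem royAdditiveSVEExponents_subset_Ici (ξ : ℂ) {β σ τ : ℝ} (hσ : 0 ≤ σ) (hτ : 0 ≤ τ)
    (hστ : σ + τ < 1) (hβ : σ + τ < β) :
    royAdditiveSVEExponents ξ β σ τ ⊆ Set.Ici (1 + β - σ - τ) := fun _ hν =>
  Set.mem_Ici.mpr (not_lt.mp fun hlt =>
    not_mem_royAdditiveSVEExponents_of_lt_dirichlet ξ hσ hτ hστ hβ hlt hν)

/-! ## §3 The open `σ/4` window -/

/-- **OPEN** — the additive small value estimate at the points `iξ` with the DIRICHLET-OPTIMAL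
exponent: for transcendental `ξ ∈ ℂ`, `β > 1`, `0 ≤ σ, 0 ≤ τ`, `σ + τ < 1`, EVERY
`ν > 1 + β − σ − τ` is an exponent, i.e. (with §2) `royAdditiveSVEExponents ξ β σ τ` is `(d, ∞)`
or `[d, ∞)`, `d = 1 + β − σ − τ`.  Typed by the soloist; [cite: Roy2010, §1, remark after
Theorem 1.1 ("Dirichlet box principle shows that it would be false for a value of ν smaller than
1+β−σ−τ. This shows a gap of σ/4 compared to our actual lower bound on ν")] proves membership
for `ν > 1 + β − (3/4)σ − τ` (Thm 1.1 (3)) and records the gap without conjecturing its closure;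
Thm 1.1 (1) there is optimal at the translated points `ξ + ir`, and Prop. 12.2 there shows the
analogous optimal statement for `m ≥ 3` points FALSE for some `ℚ`-linearly independent tuples
(coincidences among the `i₁ξ₁ + ⋯ + i_mξ_m`; no such mechanism for one point).  `Transcendental`
is necessary: for algebraic `ξ` of degree `d`, minimal polynomial `m ∈ ℤ[T]`, the polynomial
`T^{J+1} ∏_{1 ≤ i ≤ n^σ} (i^d m(T/i))^{J+1}` (`J = ⌊n^τ⌋`) lies in `RoyAdditiveSmall ξ β σ τ ν n`
for every `ν`, `n` large (its divided derivatives of order `≤ J` VANISH at the points `iξ`). -/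
@[conjecture] def RoyAdditiveDirichletExponent : Prop :=
  ∀ ξ : ℂ, Transcendental ℚ ξ → ∀ β σ τ : ℝ, 0 ≤ σ → 0 ≤ τ → 1 < β → σ + τ < 1 →
    Set.Ioi (1 + β - σ - τ) ⊆ royAdditiveSVEExponents ξ β σ τ

/-- Unfolded: for transcendental `ξ` and admissible `(β, σ, τ)` the exponent set is squeezed
between `(d, ∞)` and `[d, ∞)`, `d = 1 + β − σ − τ` (the second inclusion is §2, unconditional). -/
theorem royAdditiveDirichletExponent_iff :
    RoyAdditiveDirichletExponent ↔
      ∀ ξ : ℂ, Transcendental ℚ ξ → ∀ β σ τ : ℝ, 0 ≤ σ → 0 ≤ τ → 1 < β → σ + τ < 1 →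
        Set.Ioi (1 + β - σ - τ) ⊆ royAdditiveSVEExponents ξ β σ τ ∧
          royAdditiveSVEExponents ξ β σ τ ⊆ Set.Ici (1 + β - σ - τ) := by
  refine ⟨fun h ξ hξ β σ τ hσ hτ hβ hστ => ⟨h ξ hξ β σ τ hσ hτ hβ hστ, ?_⟩,
    fun h ξ hξ β σ τ hσ hτ hβ hστ => (h ξ hξ β σ τ hσ hτ hβ hστ).1⟩
  exact royAdditiveSVEExponents_subset_Ici ξ hσ hτ hστ (by linarith)

end Summit.Schanuel.Schanuel.Theorems
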